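import Summits.CriticalPhenomena.PercolationContinuityZ3.Theorems.PercNearOneGluingNoHeavyLowerTailGZGluingLaw
import HarnessLib

/-!
# `NoHeavyLowerTail` (stmt-CriticalPhenomena-4575) — support file: BASE EDGE and HUB STEPS of THEOREM SP for actual
# weighted graphs (prover `prim-ineq-prove-2` gen 12; THEOREM-SP.md §2 (HUB), §5, §6)

No definitions, no named facts, no sorries.  A sub-network is an edge set `E ⊆ Sym2 V`; its three-point events are read
on `ω ∩ E` under `prodBernoulli w` exactly as in `GZGluingLaw`: `Aᶜ_E = {a ↮ c}`, `Bᶜ_E = {b ↮ c}`, `D_E = {a ↮ b}`,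
`T_E = {a ↔ b off c}`; `z = P(Aᶜ ∩ Bᶜ)`, `ā = P(D ∩ Aᶜ)`, `b̄ = P(D ∩ Bᶜ)`, `n = P(D ∩ Aᶜ ∩ Bᶜ) = P(a|b|c)`, `θ = P(T)`,
`w = z − n = P(ab|c)`, `Cov(1{a ↔ c}, 1{b ↔ c}) = z − P(Aᶜ)·P(Bᶜ)`.  The LOGARITHMIC COVARIANCE BOUND of a network is
`z − P(Aᶜ)P(Bᶜ) ≤ (z − n)·log(θ/(z − n))`; the network is NON-DEGENERATE when `0 < n < z`.  As in
`GZGluingLaw.network_facts`, the events enter as variables `Ac Bc D T` with their defining equations as hypotheses.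

* `GZHubStep.reachable_inter_singleton_iff` — connectivity of a one-edge configuration;
* `GZHubStep.edge_facts` — the base piece `E = {s(a, b)}`: the bound (in fact `Cov = 0`, `θ = w`) and non-degeneracy
  whenever `0 < w(ab) < 1`;
* `GZHubStep.hub_left_facts` / `GZHubStep.hub_right_facts` — **the hub step for weighted graphs**: attaching a hub edge
  `s(a, c)` (resp. `s(b, c)`) of weight `γ < 1` to a non-degenerate network satisfying the bound yields a non-degenerate
  network satisfying the bound.  Law: `z, ā, n` (resp. `z, b̄, n`) scale by `1 − γ`, the other cell and `θ` are unchanged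
  (`GZGluingLaw.parallel_law` with the one-edge network `{s(a, c)}`), so `Cov' = (1 − γ)(Cov + γ·P(Aᶜ)·w)` and the step is
  `γ ≤ log (1/(1 − γ))` (`GZHubStep.hub_of_facts`).
With `GZGluingLaw.parallel_cov_le` and `GZSeriesStep.series_cov_le` these are all the steps of the induction proving
THEOREM SP for two-terminal series–parallel hub networks.
-/

noncomputable section

namespace Summit.CriticalPhenomena.PercolationContinuityZ3.Theorems

open MeasureTheory Literature.Probability.LatticeModels Literature.Probability.Percolation
open scoped Classical

namespace GZHubStep

variable {V : Type*}

/-- In a configuration restricted to the single pair `e`, `x ↔ y` iff `x = y` or `e = s(x, y)` is present (`x ≠ y`).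
[folklore] -/
theorem reachable_inter_singleton_iff (ω : Set (Sym2 V)) (e : Sym2 V) (x y : V) :
    (openGraph (ω ∩ {e})).Reachable x y ↔ x = y ∨ (e ∈ ω ∧ e = s(x, y) ∧ x ≠ y) := by
  constructor
  · rintro ⟨p⟩
    induction p with
    | nil => exact Or.inl rfl
    | @cons u u' u'' hadj _ ih =>
      rw [openGraph_adj] at hadj
      obtain ⟨⟨hω, he⟩, huv⟩ := hadj
      rw [Set.mem_singleton_iff] at he
      rcases ih with h | ⟨-, he', -⟩
      · subst h
        exact Or.inr ⟨he ▸ hω, he.symm, huv⟩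
      · rw [← he] at he'
        rcases Sym2.eq_iff.1 he' with ⟨h1, -⟩ | ⟨h1, -⟩
        · exact absurd h1 huv
        · exact Or.inl h1
  · rintro (h | ⟨hω, he, hxy⟩)
    · subst h; exact SimpleGraph.Reachable.refl _
    · refine SimpleGraph.Adj.reachable ?_
      rw [openGraph_adj]
      exact ⟨⟨he ▸ hω, by rw [Set.mem_singleton_iff, he]⟩, hxy⟩

/-- No two distinct vertices are joined in a configuration restricted to a pair containing `c` once the pairs at `c`
are removed (that configuration is empty). [folklore] -/
theorem not_reachable_inter_singleton_diff (ω : Set (Sym2 V)) {e : Sym2 V} {c x y : V} (hc : c ∈ e) (hxy : x ≠ y) :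
    ¬(openGraph ((ω ∩ {e}) \ {f : Sym2 V | c ∈ f})).Reachable x y := by
  have hempty : (ω ∩ {e}) \ {f : Sym2 V | c ∈ f} = ∅ := by
    ext f
    simp only [Set.mem_sdiff, Set.mem_inter_iff, Set.mem_singleton_iff, Set.mem_setOf_eq, Set.mem_empty_iff_false,
      iff_false, not_and, not_not]
    rintro ⟨-, rfl⟩
    exact hc
  rw [hempty]
  rintro ⟨p⟩
  cases p with
  | nil => exact hxy rfl
  | cons hadj _ =>
    rw [openGraph_adj] at hadj
    exact hadj.1.elim

/-- Removing the pairs at `c` from a configuration restricted to a pair NOT containing `c` changes nothing. [folklore] -/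
theorem inter_singleton_diff_of_not_mem (ω : Set (Sym2 V)) {e : Sym2 V} {c : V} (hc : c ∉ e) :
    (ω ∩ {e}) \ {f : Sym2 V | c ∈ f} = ω ∩ {e} := by
  ext f
  simp only [Set.mem_sdiff, Set.mem_inter_iff, Set.mem_singleton_iff, Set.mem_setOf_eq, and_iff_left_iff_imp, and_imp]
  rintro - rfl
  exact hc

/-! ### Real arithmetic of the hub step -/

/-- Hub arithmetic: from the cells of a network and of the network with one more hub edge of weight `γ < 1` at the
terminal whose non-connection probability is `p` (law `z' = (1−γ)z`, `p' = (1−γ)p`, `q' = q − γ(z − n)`, `n' = (1−γ)n`,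
`θ' = θ`), the logarithmic covariance bound and non-degeneracy pass to the new network:
`Cov' = (1−γ)(Cov + γ p w) ≤ (1−γ) w (log(θ/w) + γ) ≤ (1−γ) w log(θ/((1−γ)w))`. [folklore] -/
theorem hub_of_facts {z n p q θ z' n' p' q' θ' γ : ℝ}
    (hz' : z' = z * (1 - γ)) (hn' : n' = n * (1 - γ)) (hp' : p' = p * (1 - γ)) (hq' : q' = q - γ * (z - n))
    (hθ' : θ' = θ) (hγ0 : 0 ≤ γ) (hγ1 : γ < 1) (hp1 : p ≤ 1) (hn : 0 < n) (hnz : n < z) (hzθ : z - n ≤ θ)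
    (L : z - p * q ≤ (z - n) * Real.log (θ / (z - n))) :
    z' - p' * q' ≤ (z' - n') * Real.log (θ' / (z' - n')) ∧ 0 < n' ∧ n' < z' := by
  have h1γ : 0 < 1 - γ := by linarith
  have hw : 0 < z - n := by linarith
  have hθ : 0 < θ := by linarith
  refine ⟨?_, by rw [hn']; positivity, by rw [hn', hz']; nlinarith⟩
  have hw' : z' - n' = (1 - γ) * (z - n) := by rw [hz', hn']; ring
  have hlog : Real.log (θ' / (z' - n')) = Real.log (θ / (z - n)) - Real.log (1 - γ) := by
    rw [hw', hθ', show θ / ((1 - γ) * (z - n)) = θ / (z - n) / (1 - γ) by field_simp]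
    exact Real.log_div (by positivity) (by linarith)
  have hlg : Real.log (1 - γ) ≤ -γ := by
    have := Real.log_le_sub_one_of_pos h1γ
    linarith
  have hcov : z' - p' * q' = (1 - γ) * (z - p * q) + (1 - γ) * (γ * p * (z - n)) := by
    rw [hz', hp', hq']; ring
  rw [hcov, hlog, hw']
  have t1 : (1 - γ) * (z - p * q) ≤ (1 - γ) * ((z - n) * Real.log (θ / (z - n))) :=
    mul_le_mul_of_nonneg_left L h1γ.le
  have t2 : γ * p * (z - n) ≤ γ * (z - n) := by
    have : 0 ≤ γ * (z - n) * (1 - p) := mul_nonneg (mul_nonneg hγ0 hw.le) (by linarith)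
    nlinarith
  have t3 : γ * (z - n) ≤ -((z - n) * Real.log (1 - γ)) := by nlinarith
  have t4 : (1 - γ) * (γ * p * (z - n)) ≤ (1 - γ) * (-((z - n) * Real.log (1 - γ))) :=
    mul_le_mul_of_nonneg_left (t2.trans t3) h1γ.le
  nlinarith

/-! ### The one-edge networks -/

section oneEdge

variable (w : Sym2 V → unitInterval) {a b c : V}

/-- Cells of the one-edge HUB network `{s(a, c)}` read as an `(a, b)`-network: `P(a ↮ c, b ↮ c) = P(a ↮ b, a ↮ c) =
P(a|b|c) = 1 − w(ac)`, `P(a ↮ b, b ↮ c) = 1`, `P(a ↔ b off c) = 0`. [folklore] -/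
theorem hub_edge_cells_left (hab : a ≠ b) (hac : a ≠ c) (hbc : b ≠ c) :
    (prodBernoulli w).real ({ω : Set (Sym2 V) | ¬(openGraph (ω ∩ (↑({s(a, c)} : Finset (Sym2 V)) : Set (Sym2 V)))).Reachable a c} ∩ {ω : Set (Sym2 V) | ¬(openGraph (ω ∩ (↑({s(a, c)} : Finset (Sym2 V)) : Set (Sym2 V)))).Reachable b c}) = 1 - w s(a, c) ∧
    (prodBernoulli w).real ({ω : Set (Sym2 V) | ¬(openGraph (ω ∩ (↑({s(a, c)} : Finset (Sym2 V)) : Set (Sym2 V)))).Reachable a b} ∩ {ω : Set (Sym2 V) | ¬(openGraph (ω ∩ (↑({s(a, c)} : Finset (Sym2 V)) : Set (Sym2 V)))).Reachable a c}) = 1 - w s(a, c) ∧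
    (prodBernoulli w).real ({ω : Set (Sym2 V) | ¬(openGraph (ω ∩ (↑({s(a, c)} : Finset (Sym2 V)) : Set (Sym2 V)))).Reachable a b} ∩ {ω : Set (Sym2 V) | ¬(openGraph (ω ∩ (↑({s(a, c)} : Finset (Sym2 V)) : Set (Sym2 V)))).Reachable b c}) = 1 ∧
    (prodBernoulli w).real ({ω : Set (Sym2 V) | ¬(openGraph (ω ∩ (↑({s(a, c)} : Finset (Sym2 V)) : Set (Sym2 V)))).Reachable a b} ∩ {ω : Set (Sym2 V) | ¬(openGraph (ω ∩ (↑({s(a, c)} : Finset (Sym2 V)) : Set (Sym2 V)))).Reachable a c} ∩ {ω : Set (Sym2 V) | ¬(openGraph (ω ∩ (↑({s(a, c)} : Finset (Sym2 V)) : Set (Sym2 V)))).Reachable b c}) = 1 - w s(a, c) ∧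
    (prodBernoulli w).real {ω : Set (Sym2 V) | (openGraph ((ω ∩ (↑({s(a, c)} : Finset (Sym2 V)) : Set (Sym2 V))) \ {e : Sym2 V | c ∈ e})).Reachable a b} = 0 := by
  have hAc : {ω : Set (Sym2 V) | ¬(openGraph (ω ∩ (↑({s(a, c)} : Finset (Sym2 V)) : Set (Sym2 V)))).Reachable a c} =
      {ω | s(a, c) ∉ ω} := by
    ext ω
    simp only [Finset.coe_singleton, Set.mem_setOf_eq]
    rw [reachable_inter_singleton_iff]
    constructor
    · intro h hω; exact h (Or.inr ⟨hω, rfl, hac⟩)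
    · rintro h (h' | ⟨hω, -, -⟩); exacts [hac h', h hω]
  have hBc : {ω : Set (Sym2 V) | ¬(openGraph (ω ∩ (↑({s(a, c)} : Finset (Sym2 V)) : Set (Sym2 V)))).Reachable b c} =
      Set.univ := by
    ext ω
    simp only [Finset.coe_singleton, Set.mem_setOf_eq, Set.mem_univ, iff_true]
    rw [reachable_inter_singleton_iff]
    rintro (h | ⟨-, h, -⟩)
    · exact hbc h
    · rcases Sym2.eq_iff.1 h with ⟨h1, -⟩ | ⟨h1, -⟩
      · exact hab h1
      · exact hac h1
  have hD : {ω : Set (Sym2 V) | ¬(openGraph (ω ∩ (↑({s(a, c)} : Finset (Sym2 V)) : Set (Sym2 V)))).Reachable a b} =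
      Set.univ := by
    ext ω
    simp only [Finset.coe_singleton, Set.mem_setOf_eq, Set.mem_univ, iff_true]
    rw [reachable_inter_singleton_iff]
    rintro (h | ⟨-, h, -⟩)
    · exact hab h
    · rcases Sym2.eq_iff.1 h with ⟨-, h1⟩ | ⟨h1, -⟩
      · exact hbc h1.symm
      · exact hab h1
  have hT : {ω : Set (Sym2 V) | (openGraph ((ω ∩ (↑({s(a, c)} : Finset (Sym2 V)) : Set (Sym2 V))) \ {e : Sym2 V | c ∈ e})).Reachable a b} = ∅ := by
    ext ω
    simp only [Finset.coe_singleton, Set.mem_setOf_eq, Set.mem_empty_iff_false, iff_false]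
    exact not_reachable_inter_singleton_diff ω (Sym2.mem_mk_right a c) hab
  rw [hAc, hBc, hD, hT]
  simp only [Set.univ_inter, Set.inter_univ, probReal_univ, measureReal_empty, prodBernoulli_real_setOf_notMem,
    and_self]

/-- Cells of the one-edge HUB network `{s(b, c)}` read as an `(a, b)`-network: `P(a ↮ c, b ↮ c) = P(a ↮ b, b ↮ c) =
P(a|b|c) = 1 − w(bc)`, `P(a ↮ b, a ↮ c) = 1`, `P(a ↔ b off c) = 0`. [folklore] -/
theorem hub_edge_cells_right (hab : a ≠ b) (hac : a ≠ c) (hbc : b ≠ c) :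
    (prodBernoulli w).real ({ω : Set (Sym2 V) | ¬(openGraph (ω ∩ (↑({s(b, c)} : Finset (Sym2 V)) : Set (Sym2 V)))).Reachable a c} ∩ {ω : Set (Sym2 V) | ¬(openGraph (ω ∩ (↑({s(b, c)} : Finset (Sym2 V)) : Set (Sym2 V)))).Reachable b c}) = 1 - w s(b, c) ∧
    (prodBernoulli w).real ({ω : Set (Sym2 V) | ¬(openGraph (ω ∩ (↑({s(b, c)} : Finset (Sym2 V)) : Set (Sym2 V)))).Reachable a b} ∩ {ω : Set (Sym2 V) | ¬(openGraph (ω ∩ (↑({s(b, c)} : Finset (Sym2 V)) : Set (Sym2 V)))).Reachable a c}) = 1 ∧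
    (prodBernoulli w).real ({ω : Set (Sym2 V) | ¬(openGraph (ω ∩ (↑({s(b, c)} : Finset (Sym2 V)) : Set (Sym2 V)))).Reachable a b} ∩ {ω : Set (Sym2 V) | ¬(openGraph (ω ∩ (↑({s(b, c)} : Finset (Sym2 V)) : Set (Sym2 V)))).Reachable b c}) = 1 - w s(b, c) ∧
    (prodBernoulli w).real ({ω : Set (Sym2 V) | ¬(openGraph (ω ∩ (↑({s(b, c)} : Finset (Sym2 V)) : Set (Sym2 V)))).Reachable a b} ∩ {ω : Set (Sym2 V) | ¬(openGraph (ω ∩ (↑({s(b, c)} : Finset (Sym2 V)) : Set (Sym2 V)))).Reachable a c} ∩ {ω : Set (Sym2 V) | ¬(openGraph (ω ∩ (↑({s(b, c)} : Finset (Sym2 V)) : Set (Sym2 V)))).Reachable b c}) = 1 - w s(b, c) ∧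
    (prodBernoulli w).real {ω : Set (Sym2 V) | (openGraph ((ω ∩ (↑({s(b, c)} : Finset (Sym2 V)) : Set (Sym2 V))) \ {e : Sym2 V | c ∈ e})).Reachable a b} = 0 := by
  have hAc : {ω : Set (Sym2 V) | ¬(openGraph (ω ∩ (↑({s(b, c)} : Finset (Sym2 V)) : Set (Sym2 V)))).Reachable a c} =
      Set.univ := by
    ext ω
    simp only [Finset.coe_singleton, Set.mem_setOf_eq, Set.mem_univ, iff_true]
    rw [reachable_inter_singleton_iff]
    rintro (h | ⟨-, h, -⟩)
    · exact hac h
    · rcases Sym2.eq_iff.1 h with ⟨h1, -⟩ | ⟨-, h1⟩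
      · exact hab h1.symm
      · exact hac h1.symm
  have hBc : {ω : Set (Sym2 V) | ¬(openGraph (ω ∩ (↑({s(b, c)} : Finset (Sym2 V)) : Set (Sym2 V)))).Reachable b c} =
      {ω | s(b, c) ∉ ω} := by
    ext ω
    simp only [Finset.coe_singleton, Set.mem_setOf_eq]
    rw [reachable_inter_singleton_iff]
    constructor
    · intro h hω; exact h (Or.inr ⟨hω, rfl, hbc⟩)
    · rintro h (h' | ⟨hω, -, -⟩); exacts [hbc h', h hω]
  have hD : {ω : Set (Sym2 V) | ¬(openGraph (ω ∩ (↑({s(b, c)} : Finset (Sym2 V)) : Set (Sym2 V)))).Reachable a b} =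
      Set.univ := by
    ext ω
    simp only [Finset.coe_singleton, Set.mem_setOf_eq, Set.mem_univ, iff_true]
    rw [reachable_inter_singleton_iff]
    rintro (h | ⟨-, h, -⟩)
    · exact hab h
    · rcases Sym2.eq_iff.1 h with ⟨h1, -⟩ | ⟨-, h1⟩
      · exact hab h1.symm
      · exact hac h1.symm
  have hT : {ω : Set (Sym2 V) | (openGraph ((ω ∩ (↑({s(b, c)} : Finset (Sym2 V)) : Set (Sym2 V))) \ {e : Sym2 V | c ∈ e})).Reachable a b} = ∅ := by
    ext ω
    simp only [Finset.coe_singleton, Set.mem_setOf_eq, Set.mem_empty_iff_false, iff_false]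
    exact not_reachable_inter_singleton_diff ω (Sym2.mem_mk_right b c) hab
  rw [hAc, hBc, hD, hT]
  simp only [Set.univ_inter, Set.inter_univ, probReal_univ, measureReal_empty, prodBernoulli_real_setOf_notMem,
    and_self]

/-- **Base piece of THEOREM SP**: the one-edge network `{s(a, b)}` (`a, b, c` pairwise distinct, `0 < w(ab) < 1`)
satisfies the logarithmic covariance bound (`Cov = 0`, `θ = w = w(ab)`) and is non-degenerate (`n = 1 − w(ab)`, `z = 1`).
[folklore] -/
theorem edge_facts (hab : a ≠ b) (hac : a ≠ c) (hbc : b ≠ c) (hr0 : 0 < (w s(a, b) : ℝ)) (hr1 : (w s(a, b) : ℝ) < 1)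
    {Ac Bc D T : Set (Set (Sym2 V))}
    (hAc : Ac = {ω | ¬(openGraph (ω ∩ (↑({s(a, b)} : Finset (Sym2 V)) : Set (Sym2 V)))).Reachable a c})
    (hBc : Bc = {ω | ¬(openGraph (ω ∩ (↑({s(a, b)} : Finset (Sym2 V)) : Set (Sym2 V)))).Reachable b c})
    (hD : D = {ω | ¬(openGraph (ω ∩ (↑({s(a, b)} : Finset (Sym2 V)) : Set (Sym2 V)))).Reachable a b})
    (hT : T = {ω | (openGraph ((ω ∩ (↑({s(a, b)} : Finset (Sym2 V)) : Set (Sym2 V))) \ {e : Sym2 V | c ∈ e})).Reachable a b}) :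
    ((prodBernoulli w).real (Ac ∩ Bc) - (prodBernoulli w).real Ac * (prodBernoulli w).real Bc ≤
      ((prodBernoulli w).real (Ac ∩ Bc) - (prodBernoulli w).real (D ∩ Ac ∩ Bc)) *
        Real.log ((prodBernoulli w).real T / ((prodBernoulli w).real (Ac ∩ Bc) - (prodBernoulli w).real (D ∩ Ac ∩ Bc)))) ∧
    0 < (prodBernoulli w).real (D ∩ Ac ∩ Bc) ∧ (prodBernoulli w).real (D ∩ Ac ∩ Bc) < (prodBernoulli w).real (Ac ∩ Bc) := by
  have hcab : c ∉ s(a, b) := by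
    rw [Sym2.mem_iff]; rintro (h | h); exacts [hac h.symm, hbc h.symm]
  have hAc' : Ac = Set.univ := by
    rw [hAc]; ext ω
    simp only [Finset.coe_singleton, Set.mem_setOf_eq, Set.mem_univ, iff_true]
    rw [reachable_inter_singleton_iff]
    rintro (h | ⟨-, h, -⟩)
    · exact hac h
    · rcases Sym2.eq_iff.1 h with ⟨-, h1⟩ | ⟨h1, -⟩
      · exact hbc h1
      · exact hac h1
  have hBc' : Bc = Set.univ := by
    rw [hBc]; ext ω
    simp only [Finset.coe_singleton, Set.mem_setOf_eq, Set.mem_univ, iff_true]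
    rw [reachable_inter_singleton_iff]
    rintro (h | ⟨-, h, -⟩)
    · exact hbc h
    · rcases Sym2.eq_iff.1 h with ⟨h1, -⟩ | ⟨h1, -⟩
      · exact hab h1
      · exact hac h1
  have hD' : D = {ω | s(a, b) ∉ ω} := by
    rw [hD]; ext ω
    simp only [Finset.coe_singleton, Set.mem_setOf_eq]
    rw [reachable_inter_singleton_iff]
    constructor
    · intro h hω; exact h (Or.inr ⟨hω, rfl, hab⟩)
    · rintro h (h' | ⟨hω, -, -⟩); exacts [hab h', h hω]
  have hT' : T = {ω | s(a, b) ∈ ω} := by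
    rw [hT]; ext ω
    simp only [Finset.coe_singleton, Set.mem_setOf_eq, inter_singleton_diff_of_not_mem ω hcab]
    rw [reachable_inter_singleton_iff]
    constructor
    · rintro (h | ⟨hω, -, -⟩); exacts [(hab h).elim, hω]
    · intro hω; exact Or.inr ⟨hω, rfl, hab⟩
  subst hAc' hBc'
  rw [hD', hT']
  simp only [Set.inter_univ, probReal_univ, prodBernoulli_real_setOf_notMem, prodBernoulli_real_setOf_mem]
  refine ⟨?_, by linarith, by linarith⟩
  have h1 : (1 : ℝ) - (1 - (w s(a, b) : ℝ)) = w s(a, b) := by ring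
  rw [h1, div_self hr0.ne', Real.log_one]
  simp

end oneEdge

/-! ### The hub steps for weighted graphs -/

section hub

variable [Fintype V] (w : Sym2 V → unitInterval) {E : Finset (Sym2 V)} {a b c : V}

/-- **Hub step at the left terminal** (THEOREM-SP.md §2 (HUB), §5): if the network `E` (`s(a, c) ∉ E`) is non-degenerate
and satisfies the logarithmic covariance bound, then so does `insert s(a, c) E`, provided `w(ac) < 1`. [folklore] -/
theorem hub_left_facts (hab : a ≠ b) (hac : a ≠ c) (hbc : b ≠ c) (he : s(a, c) ∉ E) (hγ : (w s(a, c) : ℝ) < 1)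
    {Ac Bc D T Ac' Bc' D' T' : Set (Set (Sym2 V))}
    (hAc : Ac = {ω | ¬(openGraph (ω ∩ (↑E : Set (Sym2 V)))).Reachable a c})
    (hBc : Bc = {ω | ¬(openGraph (ω ∩ (↑E : Set (Sym2 V)))).Reachable b c})
    (hD : D = {ω | ¬(openGraph (ω ∩ (↑E : Set (Sym2 V)))).Reachable a b})
    (hT : T = {ω | (openGraph ((ω ∩ (↑E : Set (Sym2 V))) \ {e : Sym2 V | c ∈ e})).Reachable a b})
    (hAc' : Ac' = {ω | ¬(openGraph (ω ∩ (↑(insert s(a, c) E) : Set (Sym2 V)))).Reachable a c})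
    (hBc' : Bc' = {ω | ¬(openGraph (ω ∩ (↑(insert s(a, c) E) : Set (Sym2 V)))).Reachable b c})
    (hD' : D' = {ω | ¬(openGraph (ω ∩ (↑(insert s(a, c) E) : Set (Sym2 V)))).Reachable a b})
    (hT' : T' = {ω | (openGraph ((ω ∩ (↑(insert s(a, c) E) : Set (Sym2 V))) \ {e : Sym2 V | c ∈ e})).Reachable a b})
    (hn : 0 < (prodBernoulli w).real (D ∩ Ac ∩ Bc))
    (hnz : (prodBernoulli w).real (D ∩ Ac ∩ Bc) < (prodBernoulli w).real (Ac ∩ Bc))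
    (L : (prodBernoulli w).real (Ac ∩ Bc) - (prodBernoulli w).real Ac * (prodBernoulli w).real Bc ≤
      ((prodBernoulli w).real (Ac ∩ Bc) - (prodBernoulli w).real (D ∩ Ac ∩ Bc)) *
        Real.log ((prodBernoulli w).real T / ((prodBernoulli w).real (Ac ∩ Bc) - (prodBernoulli w).real (D ∩ Ac ∩ Bc)))) :
    ((prodBernoulli w).real (Ac' ∩ Bc') - (prodBernoulli w).real Ac' * (prodBernoulli w).real Bc' ≤
      ((prodBernoulli w).real (Ac' ∩ Bc') - (prodBernoulli w).real (D' ∩ Ac' ∩ Bc')) *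
        Real.log ((prodBernoulli w).real T' / ((prodBernoulli w).real (Ac' ∩ Bc') - (prodBernoulli w).real (D' ∩ Ac' ∩ Bc')))) ∧
    0 < (prodBernoulli w).real (D' ∩ Ac' ∩ Bc') ∧
    (prodBernoulli w).real (D' ∩ Ac' ∩ Bc') < (prodBernoulli w).real (Ac' ∩ Bc') := by
  set E₂ : Finset (Sym2 V) := {s(a, c)} with hE₂
  have hunion : (↑(insert s(a, c) E) : Set (Sym2 V)) = (↑E : Set (Sym2 V)) ∪ ↑E₂ := by
    rw [hE₂, Finset.coe_insert, Finset.coe_singleton, Set.insert_eq, Set.union_comm]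
  have h₁ : ∀ e ∈ (↑E : Set (Sym2 V)), ∀ z ∈ e, z ∈ (Set.univ : Set V) := fun _ _ _ _ => Set.mem_univ _
  have h₂ : ∀ e ∈ (↑E₂ : Set (Sym2 V)), ∀ z ∈ e, z ∈ ({a, c} : Set V) := by
    intro e he' z hz
    rw [hE₂, Finset.coe_singleton, Set.mem_singleton_iff] at he'
    subst he'
    rcases Sym2.mem_iff.1 hz with rfl | rfl <;> simp
  have hS : (Set.univ : Set V) ∩ {a, c} ⊆ {a, b, c} := by
    rintro z ⟨-, hz⟩; rcases hz with rfl | rfl <;> simp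
  have hdisj : Disjoint E E₂ := by rw [hE₂]; exact Finset.disjoint_singleton_right.2 he
  obtain ⟨pz, pa, pb, pn, pt⟩ := GZGluingLaw.parallel_law w h₁ h₂ hS hdisj hab hac hbc
  rw [← hunion] at pz pa pb pn pt
  obtain ⟨cz, ca, cb, cn, ct⟩ := hub_edge_cells_left w hab hac hbc
  rw [← hE₂] at cz ca cb cn ct
  rw [cz] at pz; rw [ca] at pa; rw [cb] at pb; rw [cn] at pn; rw [ct] at pt
  rw [← hAc, ← hBc, ← hAc', ← hBc'] at pz
  rw [← hAc, ← hD, ← hAc', ← hD'] at pa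
  rw [← hBc, ← hD, ← hBc', ← hD'] at pb
  rw [← hAc, ← hBc, ← hD, ← hAc', ← hBc', ← hD'] at pn
  rw [← hT, ← hT'] at pt
  obtain ⟨f1u, f1v, -, -, -, f1t, -, -, -⟩ := GZGluingLaw.network_facts w (↑E : Set (Sym2 V)) hac hAc hBc hD hT
  obtain ⟨f2u, f2v, -, -, -, -, -, -, -⟩ :=
    GZGluingLaw.network_facts w (↑(insert s(a, c) E) : Set (Sym2 V)) hac hAc' hBc' hD' hT'
  have hu1 : (prodBernoulli w).real Ac ≤ 1 := measureReal_le_one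
  refine hub_of_facts (γ := (w s(a, c) : ℝ)) ?_ ?_ ?_ ?_ ?_ (w s(a, c)).2.1 hγ hu1 hn hnz f1t L
  · rw [pz]
  · rw [pn]
  · rw [f2u, f1u, pz, pa, pn]; ring
  · rw [f2v, f1v, pz, pb, pn]; ring
  · linarith [pt]

/-- **Hub step at the right terminal** (THEOREM-SP.md §2 (HUB), §5): if the network `E` (`s(b, c) ∉ E`) is
non-degenerate and satisfies the logarithmic covariance bound, then so does `insert s(b, c) E`, provided `w(bc) < 1`.
[folklore] -/
theorem hub_right_facts (hab : a ≠ b) (hac : a ≠ c) (hbc : b ≠ c) (he : s(b, c) ∉ E) (hγ : (w s(b, c) : ℝ) < 1)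
    {Ac Bc D T Ac' Bc' D' T' : Set (Set (Sym2 V))}
    (hAc : Ac = {ω | ¬(openGraph (ω ∩ (↑E : Set (Sym2 V)))).Reachable a c})
    (hBc : Bc = {ω | ¬(openGraph (ω ∩ (↑E : Set (Sym2 V)))).Reachable b c})
    (hD : D = {ω | ¬(openGraph (ω ∩ (↑E : Set (Sym2 V)))).Reachable a b})
    (hT : T = {ω | (openGraph ((ω ∩ (↑E : Set (Sym2 V))) \ {e : Sym2 V | c ∈ e})).Reachable a b})
    (hAc' : Ac' = {ω | ¬(openGraph (ω ∩ (↑(insert s(b, c) E) : Set (Sym2 V)))).Reachable a c})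
    (hBc' : Bc' = {ω | ¬(openGraph (ω ∩ (↑(insert s(b, c) E) : Set (Sym2 V)))).Reachable b c})
    (hD' : D' = {ω | ¬(openGraph (ω ∩ (↑(insert s(b, c) E) : Set (Sym2 V)))).Reachable a b})
    (hT' : T' = {ω | (openGraph ((ω ∩ (↑(insert s(b, c) E) : Set (Sym2 V))) \ {e : Sym2 V | c ∈ e})).Reachable a b})
    (hn : 0 < (prodBernoulli w).real (D ∩ Ac ∩ Bc))
    (hnz : (prodBernoulli w).real (D ∩ Ac ∩ Bc) < (prodBernoulli w).real (Ac ∩ Bc))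
    (L : (prodBernoulli w).real (Ac ∩ Bc) - (prodBernoulli w).real Ac * (prodBernoulli w).real Bc ≤
      ((prodBernoulli w).real (Ac ∩ Bc) - (prodBernoulli w).real (D ∩ Ac ∩ Bc)) *
        Real.log ((prodBernoulli w).real T / ((prodBernoulli w).real (Ac ∩ Bc) - (prodBernoulli w).real (D ∩ Ac ∩ Bc)))) :
    ((prodBernoulli w).real (Ac' ∩ Bc') - (prodBernoulli w).real Ac' * (prodBernoulli w).real Bc' ≤
      ((prodBernoulli w).real (Ac' ∩ Bc') - (prodBernoulli w).real (D' ∩ Ac' ∩ Bc')) *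
        Real.log ((prodBernoulli w).real T' / ((prodBernoulli w).real (Ac' ∩ Bc') - (prodBernoulli w).real (D' ∩ Ac' ∩ Bc')))) ∧
    0 < (prodBernoulli w).real (D' ∩ Ac' ∩ Bc') ∧
    (prodBernoulli w).real (D' ∩ Ac' ∩ Bc') < (prodBernoulli w).real (Ac' ∩ Bc') := by
  set E₂ : Finset (Sym2 V) := {s(b, c)} with hE₂
  have hunion : (↑(insert s(b, c) E) : Set (Sym2 V)) = (↑E : Set (Sym2 V)) ∪ ↑E₂ := by
    rw [hE₂, Finset.coe_insert, Finset.coe_singleton, Set.insert_eq, Set.union_comm]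
  have h₁ : ∀ e ∈ (↑E : Set (Sym2 V)), ∀ z ∈ e, z ∈ (Set.univ : Set V) := fun _ _ _ _ => Set.mem_univ _
  have h₂ : ∀ e ∈ (↑E₂ : Set (Sym2 V)), ∀ z ∈ e, z ∈ ({b, c} : Set V) := by
    intro e he' z hz
    rw [hE₂, Finset.coe_singleton, Set.mem_singleton_iff] at he'
    subst he'
    rcases Sym2.mem_iff.1 hz with rfl | rfl <;> simp
  have hS : (Set.univ : Set V) ∩ {b, c} ⊆ {a, b, c} := by
    rintro z ⟨-, hz⟩; rcases hz with rfl | rfl <;> simp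
  have hdisj : Disjoint E E₂ := by rw [hE₂]; exact Finset.disjoint_singleton_right.2 he
  obtain ⟨pz, pa, pb, pn, pt⟩ := GZGluingLaw.parallel_law w h₁ h₂ hS hdisj hab hac hbc
  rw [← hunion] at pz pa pb pn pt
  obtain ⟨cz, ca, cb, cn, ct⟩ := hub_edge_cells_right w hab hac hbc
  rw [← hE₂] at cz ca cb cn ct
  rw [cz] at pz; rw [ca] at pa; rw [cb] at pb; rw [cn] at pn; rw [ct] at pt
  rw [← hAc, ← hBc, ← hAc', ← hBc'] at pz
  rw [← hAc, ← hD, ← hAc', ← hD'] at pa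
  rw [← hBc, ← hD, ← hBc', ← hD'] at pb
  rw [← hAc, ← hBc, ← hD, ← hAc', ← hBc', ← hD'] at pn
  rw [← hT, ← hT'] at pt
  obtain ⟨f1u, f1v, -, -, -, f1t, -, -, -⟩ := GZGluingLaw.network_facts w (↑E : Set (Sym2 V)) hac hAc hBc hD hT
  obtain ⟨f2u, f2v, -, -, -, -, -, -, -⟩ :=
    GZGluingLaw.network_facts w (↑(insert s(b, c) E) : Set (Sym2 V)) hac hAc' hBc' hD' hT'
  have hv1 : (prodBernoulli w).real Bc ≤ 1 := measureReal_le_one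
  have L' := L
  rw [mul_comm] at L'
  rw [mul_comm ((prodBernoulli w).real Ac') ((prodBernoulli w).real Bc')]
  refine hub_of_facts (γ := (w s(b, c) : ℝ)) ?_ ?_ ?_ ?_ ?_ (w s(b, c)).2.1 hγ hv1 hn hnz f1t L'
  · rw [pz]
  · rw [pn]
  · rw [f2v, f1v, pz, pb, pn]; ring
  · rw [f2u, f1u, pz, pa, pn]; ring
  · linarith [pt]

end hub

end GZHubStep

end Summit.CriticalPhenomena.PercolationContinuityZ3.Theorems
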